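import Summits.FinalStateConjecture.FinalStateConjecture.Theses.ZeroEnergyKerrOrBomb
import Literature.Geometry.Lorentzian.BlackHoles
import Literature.Geometry.Lorentzian.CausalityOpennessProofs
import Literature.Geometry.Lorentzian.LorentzianMetricProofs
import Literature.Geometry.Lorentzian.CauchyProblemCauchy
import Literature.Geometry.Manifold.OpenSubmanifoldMFDeriv

/-!
# `ZeroEnergyRigidity`, line `global-horizon-killing-field` — stub `stub_kerrChartTransfer`

Crux `stmt-FinalStateConjecture-10690` (`Theses.ZeroEnergyKerrOrBomb.ZeroEnergyRigidity`), stub S4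
of the lead's skeleton.  The vendored conclusion of the black-hole uniqueness theorems,
`StationaryAFBlackHole.IsIsometricToKerrExterior hF hP hres` — a `C^∞` diffeomorphism `Φ` of the
open submanifold `⟨⟨M_ext⟩⟩ = 𝓑.docOpens hF hP` onto the ingoing Kerr–Schild exterior chart
`Kerr.exterior M a` (`|a| < M`) pulling the smooth Kerr metric back to the restricted metric
`𝓑.metric|doc` — taken at the DISCHARGED prelude facts (`hF`, `hP` := O'Neill 1983, Lemma 14.3
for boundaryless carriers; `hres := PseudoRiemannianMetric.contMDiff_restrict_holds`), is
converted into the fact-free chart form in which the crux is typed: there are `|a| < M` and an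
injective smooth isometric immersion `Ψ : Kerr.exterior M a → 𝓑` with `range Ψ = 𝓑.doc`.  The
conversion is proved for ARBITRARY proofs `hF hP hres`
(`kerrConclusion_of_isIsometricToKerrExterior`); the registered stub `stub_kerrChartTransfer` is
its instance at the discharged facts.

Proof (bookkeeping; O'Neill 1983, Ch. 3, pp. 58–59 and 90–91): `Ψ := Subtype.val ∘ Φ.symm`.
* `Φ.symm` is an isometric immersion of the Kerr metric INTO the restricted metric:
  `Φ.symm^* (g|doc) = Φ.symm^* (Φ^* g_Kerr) = (Φ ∘ Φ.symm)^* g_Kerr = id^* g_Kerr = g_Kerr`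
  (`pullbackBilin_comp`, `pullbackBilin_id`; `Φ^* g_Kerr = g|doc` is the `IsIsometry` clause) —
  `isIsometricImmersion_symm`;
* the inclusion `Subtype.val : 𝓑.docOpens hF hP → 𝓑.carrier` is an isometric immersion of the
  restricted metric into `g`: its differential is the identity
  (`OpenSubmanifold.mfderiv_subtype_val`) and `(g|U) x = g ↑x` by `rfl` —
  `isIsometricImmersion_subtypeVal`;
* isometric immersions compose (`IsIsometricImmersion.comp`), `Ψ` is injective as a composite of
  injections, and `range Ψ = Subtype.val '' univ = doc` because `Φ.symm` is onto.

References: B. O'Neill, *Semi-Riemannian Geometry* (1983), Ch. 3, Def. 3.9, pp. 57–59, 90–91;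
P. T. Chruściel, J. L. Costa, arXiv:0806.0016, Thm. 1.3 (the form of the conclusion).
-/

noncomputable section

-- summit = problem name (D-0017)
set_option linter.dupNamespace false

namespace Summit.FinalStateConjecture.FinalStateConjecture.Theorems.ZeroEnergyRigidity.GlobalHorizonKillingField.KerrChartTransfer

open Set Function Literature.Geometry.Lorentzian
open scoped Manifold ContDiff Topology

/-! ## Two general isometric immersions -/

section General

variable {E : Type*} [NormedAddCommGroup E] [NormedSpace ℝ E] {H : Type*} [TopologicalSpace H]
  {I : ModelWithCorners ℝ E H} {M : Type*} [TopologicalSpace M] [ChartedSpace H M]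
  [IsManifold I ∞ M]
  {E' : Type*} [NormedAddCommGroup E'] [NormedSpace ℝ E'] {H' : Type*} [TopologicalSpace H']
  {I' : ModelWithCorners ℝ E' H'} {N : Type*} [TopologicalSpace N] [ChartedSpace H' N]
  [IsManifold I' ∞ N]

/-- **The inclusion of an open submanifold is an isometric immersion of the restricted metric**:
`Subtype.val : (U, g|U) → (M, g)` is `C^n` (`contMDiff_subtype_val`), its differential is the
identity (`OpenSubmanifold.mfderiv_subtype_val`), and `(g|U)_x = g_{↑x}` definitionally, so
`val^* g = g|U`.  O'Neill 1983, Ch. 3, p. 57 and Ch. 4, pp. 97–98. -/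
theorem isIsometricImmersion_subtypeVal {n : ℕ∞ω}
    (hres : PseudoRiemannianMetric.contMDiff_restrict (I := I) (n := n) (M := M))
    (g : PseudoRiemannianMetric I n E (TangentSpace I : M → Type _))
    (U : TopologicalSpace.Opens M) :
    PseudoRiemannianMetric.IsIsometricImmersion (g.restrict hres U) g (Subtype.val : U → M) := by
  refine ⟨contMDiff_subtype_val, fun x ↦ ?_⟩
  ext v w
  rw [pullbackBilin_apply, Literature.Geometry.Manifold.OpenSubmanifold.mfderiv_subtype_val]
  rfl

/-- **The inverse of an isometry is an isometric immersion**: if the `C^∞` diffeomorphism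
`Φ : (N, g_N) ≅ (M, g_M)` satisfies `Φ^* g_M = g_N`, then `Φ.symm : M → N` is smooth with
`Φ.symm^* g_N = Φ.symm^* (Φ^* g_M) = (Φ ∘ Φ.symm)^* g_M = id^* g_M = g_M` (chain rule for
pull-backs, `pullbackBilin_comp`, and `pullbackBilin_id`).  O'Neill 1983, Ch. 3, pp. 58–59. -/
theorem isIsometricImmersion_symm
    {gN : PseudoRiemannianMetric I' ∞ E' (TangentSpace I' : N → Type _)}
    {gM : PseudoRiemannianMetric I ∞ E (TangentSpace I : M → Type _)}
    {Φ : Diffeomorph I' I N M ∞} (hΦ : PseudoRiemannianMetric.IsIsometry gN gM Φ) :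
    PseudoRiemannianMetric.IsIsometricImmersion gM gN Φ.symm := by
  refine ⟨Φ.symm.contMDiff, fun y ↦ ?_⟩
  have hcomp := pullbackBilin_comp (Φ.contMDiff.mdifferentiable (by simp))
    (Φ.symm.contMDiff.mdifferentiable (by simp)) gM.val
  have hid : ((Φ : N → M) ∘ Φ.symm) = id := funext fun x ↦ Φ.apply_symm_apply x
  rw [hid, pullbackBilin_id,
    show pullbackBilin (I := I) (I' := I') Φ gM.val = gN.val from funext hΦ] at hcomp
  exact (congrFun hcomp y).symm

end General

/-! ## The chart transfer -/

/-- **Chart transfer, general form.**  For ANY proofs `hF hP hres` of the prelude facts, the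
vendored conclusion `𝓑.IsIsometricToKerrExterior hF hP hres` (a `C^∞` diffeomorphism `Φ` of
`𝓑.docOpens hF hP` onto `Kerr.exterior M a`, `|a| < M`, with `Φ^* g_Kerr = g|doc`) yields the
fact-free chart form of the crux conclusion with `Ψ := Subtype.val ∘ Φ.symm`: injective
(composite of injections), `range Ψ = doc` (`Φ.symm` is onto and `range val = doc`), and an
isometric immersion as the composite of `isIsometricImmersion_symm` and
`isIsometricImmersion_subtypeVal`.  O'Neill 1983, Ch. 3, pp. 58–59; Chruściel–Costa,
arXiv:0806.0016, Thm. 1.3 (form of the conclusion). -/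
theorem kerrConclusion_of_isIsometricToKerrExterior (𝓑 : StationaryAFBlackHole.{0})
    [Kerr.Facts] (hF : 𝓑.metric.isOpen_chronologicalFuture 𝓑.timeOrientation)
    (hP : 𝓑.metric.isOpen_chronologicalPast 𝓑.timeOrientation)
    (hres : PseudoRiemannianMetric.contMDiff_restrict (I := 𝓡 4) (n := (∞ : ℕ∞ω))
      (M := 𝓑.carrier))
    (h : 𝓑.IsIsometricToKerrExterior hF hP hres) :
    ∃ (M a : ℝ), Kerr.IsSubextremal M a ∧ ∃ Ψ : Kerr.exterior M a → 𝓑.carrier,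
      Function.Injective Ψ ∧ Set.range Ψ = 𝓑.doc ∧
        PseudoRiemannianMetric.IsIsometricImmersion
          (Kerr.smoothMetric M a (Kerr.rPlus M a)).toPseudoRiemannianMetric
          𝓑.metric.toPseudoRiemannianMetric Ψ := by
  obtain ⟨M, a, hMa, Φ, hΦ⟩ := h
  have hincl : PseudoRiemannianMetric.IsIsometricImmersion
      (𝓑.metric.restrict hres (𝓑.docOpens hF hP)).toPseudoRiemannianMetric
      𝓑.metric.toPseudoRiemannianMetric (Subtype.val : 𝓑.docOpens hF hP → 𝓑.carrier) :=
    isIsometricImmersion_subtypeVal hres 𝓑.metric.toPseudoRiemannianMetric (𝓑.docOpens hF hP)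
  have hsymm : PseudoRiemannianMetric.IsIsometricImmersion
      (Kerr.smoothMetric M a (Kerr.rPlus M a)).toPseudoRiemannianMetric
      (𝓑.metric.restrict hres (𝓑.docOpens hF hP)).toPseudoRiemannianMetric Φ.symm :=
    isIsometricImmersion_symm hΦ
  have hsurj : Function.Surjective (Φ.symm : Kerr.exterior M a → 𝓑.docOpens hF hP) :=
    fun x ↦ ⟨Φ x, Φ.symm_apply_apply x⟩
  refine ⟨M, a, hMa, Subtype.val ∘ Φ.symm, Subtype.val_injective.comp Φ.symm.injective, ?_,
    hincl.comp hsymm⟩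
  rw [Set.range_comp, hsurj.range_eq, Set.image_univ]
  exact Subtype.range_coe_subtype

/-- **Stub S4 · kerrChartTransfer** (registered signature of the lead's skeleton for crux
`stmt-FinalStateConjecture-10690`, line `global-horizon-killing-field`): the vendored conclusion
`IsIsometricToKerrExterior`, taken at the discharged prelude facts
(`LorentzianMetric.isOpen_chronologicalFuture/Past_holds_of_boundaryless`,
`PseudoRiemannianMetric.contMDiff_restrict_holds`), yields the fact-free chart form of the crux
conclusion.  Instance of `kerrConclusion_of_isIsometricToKerrExterior`. -/
theorem stub_kerrChartTransfer :
    ∀ (𝓑 : StationaryAFBlackHole.{0}) [Kerr.Facts],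
      𝓑.IsIsometricToKerrExterior LorentzianMetric.isOpen_chronologicalFuture_holds_of_boundaryless
          LorentzianMetric.isOpen_chronologicalPast_holds_of_boundaryless
          PseudoRiemannianMetric.contMDiff_restrict_holds →
        ∃ (M a : ℝ), Kerr.IsSubextremal M a ∧ ∃ Ψ : Kerr.exterior M a → 𝓑.carrier,
          Function.Injective Ψ ∧ Set.range Ψ = 𝓑.doc ∧
            PseudoRiemannianMetric.IsIsometricImmersion
              (Kerr.smoothMetric M a (Kerr.rPlus M a)).toPseudoRiemannianMetric
              𝓑.metric.toPseudoRiemannianMetric Ψ :=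
  fun 𝓑 _ h ↦ kerrConclusion_of_isIsometricToKerrExterior 𝓑 _ _ _ h

end Summit.FinalStateConjecture.FinalStateConjecture.Theorems.ZeroEnergyRigidity.GlobalHorizonKillingField.KerrChartTransfer

end
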